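import Summits.HubbardSuperconductivity.HubbardSuperconductivity.Theorems.AnisotropyChordFourTorusKernelCertXDecideA
import Summits.HubbardSuperconductivity.HubbardSuperconductivity.Theorems.AnisotropyChordFourTorusKernelCertYDecideA
import Summits.HubbardSuperconductivity.HubbardSuperconductivity.Theorems.AnisotropyChordFourTorusKernelCertYDecideB
import Summits.HubbardSuperconductivity.HubbardSuperconductivity.Theorems.AnisotropyChordFourTorusKernelCertYDecideC
import Summits.HubbardSuperconductivity.HubbardSuperconductivity.Theorems.AnisotropyChordFerroSideChordFour

/-!
# Route `AnisotropyChord` / crux `ChordXY` at `M = 4`: the seven kernel certificates READ INTO `ℝ` as inequalities between the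
# reduced forms `L(v) = lowerC`, `A(v) = hopC`, `W(v) = isingC`, `N(v) = normC` (prover seat `hubbard-h0-rotor-p1` g18)

Literal dictionary: `lLit = lEntry` (`lAgree`), `aLit = activeEdges` (`aAgree`), `hLit = hEntry` (from g17's `pEntry 1 = pLit 1`).
PSD: `psd_of_dominant_residual` (g17) with `q = 1` and the integer factors `cholX 0`, `cholY 1..6`.  Results (for every `v : ℕ → ℝ`):
* `certX0`: `nw0c·(20A + 20W − 38N) + 70·lin(w0)² ≥ 0` — the rank-one-shifted GAP certificate at the KLS point (`θ + 8 = 19/10`, `t = 7/2`);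
* `certY1`: `nac·(800A + 800W + 92N − 40·D₃₂) − 200·eac·N ≥ 0` (`D₃₂(v) = Σ n8 (W_r + 3/2)² v²`; variance certificate `s² = 23/10`);
* `certY2`: `nac·(4L + 320A + 320W − 266N) − 80·eac·N ≥ 0` (`Λ₀ ≥ 133/2`);  `certY3`: `nac·(−4L + 240A + 240W + 278N) − 60·eac·N ≥ 0` (`Λ₀ ≤ 139/2`);
* `certY4`: `nac·(40A + 36W − 5N) − 10·eac·N ≥ 0` (`⟨W⟩₀ ≤ −5/4`);
* `certY5`: `nbc·(4L + 240A + 480W) − 60·ebm·N ≥ 0` (`Δ = −1`);  `certY6`: `nbc·(800L + 48000A + 52080W − 50874N) − ebj·N ≥ 0` (`Δ = −17/200`).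
-/

set_option linter.style.longLine false
set_option linter.dupNamespace false
set_option autoImplicit false

open Finset

namespace Summit.HubbardSuperconductivity.HubbardSuperconductivity.Theorems.AnisotropyChord.FourTorus

/-! ## Literal dictionary -/

/-- `lLit = lEntry`. [folklore] -/
theorem lLit_eq {r s : ℕ} (hr : r < 58) (hs : s < 58) : lLit r s = lEntry r s := by
  have key : ∀ h < 2, lAgreeB h = true → ∀ i < 29, ∀ s < 58, lEntry (29 * h + i) s = lLit (29 * h + i) s := by
    intro h _ hp i hi s hs
    have := allN_sound (allN_sound hp i hi) s hs
    rwa [beq_iff_eq] at this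
  by_cases hlt : r < 29
  · have := key 0 (by norm_num) lAgree_lo r hlt s hs; simp at this; exact this.symm
  · have := key 1 (by norm_num) lAgree_hi (r - 29) (by omega) s hs
    rw [show 29 * 1 + (r - 29) = r by omega] at this; exact this.symm

/-- `aLit = activeEdges`. [folklore] -/
theorem aLit_eq {r : ℕ} (hr : r < 58) : aLit r = activeEdges r := by
  have := allN_sound aAgree r hr
  rw [beq_iff_eq] at this; exact this.symm

/-- `hLit = hEntry`. [folklore] -/
theorem hLit_eq {r s : ℕ} (hr : r < 58) (hs : s < 58) : hLit r s = hEntry r s := by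
  unfold hLit
  rw [← pEntry_eq_pLit (Or.inr rfl) hr hs, lLit_eq hr hs]
  unfold pEntry
  have e : (30 * (lEntry r s : ℤ) + 225 * hEntry r s +
      (if r = s then (n8 r : ℤ) * (-1080 * (1 + ((1:ℕ):ℤ)) + (1 - ((1:ℕ):ℤ)) * (7200 - 450 * (activeEdges r : ℤ)) + 480 * (1 - ((1:ℕ):ℤ))) else 0)
      - 30 * (lEntry r s : ℤ) + (if r = s then 2160 * (n8 r : ℤ) else 0)) = 225 * hEntry r s := by
    split_ifs <;> push_cast <;> ring
  rw [e, Int.mul_ediv_cancel_left _ (by norm_num)]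

/-! ## Generic pieces -/

/-- a rank-one matrix as a quadratic form. [folklore] -/
theorem quad_rankOne (v c : ℕ → ℝ) :
    ∑ r ∈ range 58, ∑ s ∈ range 58, v r * v s * (c r * c s) = (∑ r ∈ range 58, c r * v r) ^ 2 := by
  rw [sq, Finset.sum_mul_sum]
  exact Finset.sum_congr rfl fun r _ => Finset.sum_congr rfl fun s _ => by ring

/-- `Σ v v hLit = 4·A(v)`. [folklore] -/
theorem quad_hLit (v : ℕ → ℝ) : ∑ r ∈ range 58, ∑ s ∈ range 58, v r * v s * (hLit r s : ℝ) = 4 * hopC v := by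
  rw [← quad_hOff, ← quad_hEntry_eq_hOff]
  refine Finset.sum_congr rfl fun r hr => Finset.sum_congr rfl fun s hs => ?_
  rw [hLit_eq (mem_range.1 hr) (mem_range.1 hs)]

/-- `Σ v v lLit = L(v)`. [folklore] -/
theorem quad_lLit (v : ℕ → ℝ) : ∑ r ∈ range 58, ∑ s ∈ range 58, v r * v s * ((lLit r s : ℤ) : ℝ) = lowerC v := by
  rw [← quad_lEntry]
  refine Finset.sum_congr rfl fun r hr => Finset.sum_congr rfl fun s hs => ?_
  rw [lLit_eq (mem_range.1 hr) (mem_range.1 hs)]; push_cast; rfl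

/-- the linear functional `Σ_r n8 r · w r · v r` of an integer class vector. [folklore] -/
noncomputable def linC (w : ℕ → ℕ) (v : ℕ → ℝ) : ℝ := ∑ r ∈ range 58, (n8 r : ℝ) * (w r : ℝ) * v r
/-- `D₃₂(v) = Σ_r n8 r (W_r + 3/2)² v_r²` (`W_r = 8 − A_r/2`): the squared deviation of the Ising diagonal from `−3/2`. [folklore] -/
noncomputable def dev32C (v : ℕ → ℝ) : ℝ := ∑ r ∈ range 58, (n8 r : ℝ) * ((8 - (1/2 : ℝ) * (activeEdges r : ℝ)) + 3/2) ^ 2 * v r ^ 2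

/-- diagonal sums in the reduced forms: `Σ n8 (α(16−A) + β) v² = 2α W(v) + β N(v)`. [folklore] -/
theorem diag_sum (α β : ℝ) (v : ℕ → ℝ) :
    ∑ r ∈ range 58, (n8 r : ℝ) * (α * (16 - (activeEdges r : ℝ)) + β) * v r ^ 2 = 2 * α * isingC v + β * normC v := by
  unfold isingC normC
  rw [Finset.mul_sum, Finset.mul_sum, ← Finset.sum_add_distrib]
  exact Finset.sum_congr rfl fun r _ => by ring

/-! ## Reading a certificate -/

/-- residual as a `Finset` sum. [folklore] -/
theorem residX_eq (k i j : ℕ) : residX k i j = pX k i j - ∑ t ∈ range 58, cholX k i t * cholX k j t := by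
  unfold residX; rw [iter_add_eq, zero_add]
/-- residual as a `Finset` sum. [folklore] -/
theorem residY_eq (k i j : ℕ) : residY k i j = pY k i j - ∑ t ∈ range 58, cholY k i t * cholY k j t := by
  unfold residY; rw [iter_add_eq, zero_add]

/-- generic reader: dominance on both halves + symmetry ⇒ the integer matrix is PSD over `ℝ`. [folklore] -/
theorem psd_of_checks (A C : ℕ → ℕ → ℤ) (resid : ℕ → ℕ → ℤ) (offS : ℕ → ℕ)
    (hres : ∀ i j, resid i j = A i j - ∑ t ∈ range 58, C i t * C j t)
    (hoff : ∀ i, offS i = sumN 58 fun j => if j = i then 0 else (resid i j).natAbs)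
    (hdom : ∀ h < 2, (allN 29 fun i => decide ((offS (29 * h + i) : ℤ) ≤ resid (29 * h + i) (29 * h + i))) = true)
    (hsym : (allN 58 fun i => allN 58 fun j => A i j == A j i) = true) (v : ℕ → ℝ) :
    0 ≤ ∑ i ∈ range 58, ∑ j ∈ range 58, v i * v j * (A i j : ℝ) := by
  have hs : ∀ i < 58, ∀ j < 58, A i j = A j i := by
    intro i hi j hj
    have := allN_sound (allN_sound hsym i hi) j hj
    rwa [beq_iff_eq] at this
  have hd : ∀ i < 58, (∑ j ∈ range 58, if j = i then 0 else |1 * A i j - ∑ k ∈ range 58, C i k * C j k|)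
      ≤ 1 * A i i - ∑ k ∈ range 58, C i k * C i k := by
    intro i hi
    have hrow : decide ((offS i : ℤ) ≤ resid i i) = true := by
      by_cases hlt : i < 29
      · have := allN_sound (hdom 0 (by norm_num)) i hlt; simpa using this
      · have := allN_sound (hdom 1 (by norm_num)) (i - 29) (by omega)
        rwa [show 29 * 1 + (i - 29) = i by omega] at this
    rw [decide_eq_true_eq, hoff, sumN_eq, hres] at hrow
    push_cast at hrow
    simp only [one_mul]
    refine le_trans (le_of_eq (Finset.sum_congr rfl fun j _ => ?_)) hrow
    split_ifs
    · rfl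
    · rw [hres]
  have h := psd_of_dominant_residual 58 1 one_pos A C hs hd v
  exact h

/-- certificate matrix `X0` is PSD. [folklore] -/
theorem quadX0_nonneg (v : ℕ → ℝ) : 0 ≤ ∑ i ∈ range 58, ∑ j ∈ range 58, v i * v j * (pX 0 i j : ℝ) :=
  psd_of_checks (pX 0) (cholX 0) (residX 0) (offSumX 0) (residX_eq 0) (fun _ => rfl)
    (fun h hh => by interval_cases h; exacts [certDomX_0_lo, certDomX_0_hi]) certSymX_0 v
/-- certificate matrix `Y1` is PSD. [folklore] -/
theorem quadY1_nonneg (v : ℕ → ℝ) : 0 ≤ ∑ i ∈ range 58, ∑ j ∈ range 58, v i * v j * (pY 1 i j : ℝ) :=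
  psd_of_checks (pY 1) (cholY 1) (residY 1) (offSumY 1) (residY_eq 1) (fun _ => rfl)
    (fun h hh => by interval_cases h; exacts [certDomY_1_lo, certDomY_1_hi]) certSymY_1 v
/-- certificate matrix `Y2` is PSD. [folklore] -/
theorem quadY2_nonneg (v : ℕ → ℝ) : 0 ≤ ∑ i ∈ range 58, ∑ j ∈ range 58, v i * v j * (pY 2 i j : ℝ) :=
  psd_of_checks (pY 2) (cholY 2) (residY 2) (offSumY 2) (residY_eq 2) (fun _ => rfl)
    (fun h hh => by interval_cases h; exacts [certDomY_2_lo, certDomY_2_hi]) certSymY_2 v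
/-- certificate matrix `Y3` is PSD. [folklore] -/
theorem quadY3_nonneg (v : ℕ → ℝ) : 0 ≤ ∑ i ∈ range 58, ∑ j ∈ range 58, v i * v j * (pY 3 i j : ℝ) :=
  psd_of_checks (pY 3) (cholY 3) (residY 3) (offSumY 3) (residY_eq 3) (fun _ => rfl)
    (fun h hh => by interval_cases h; exacts [certDomY_3_lo, certDomY_3_hi]) certSymY_3 v
/-- certificate matrix `Y4` is PSD. [folklore] -/
theorem quadY4_nonneg (v : ℕ → ℝ) : 0 ≤ ∑ i ∈ range 58, ∑ j ∈ range 58, v i * v j * (pY 4 i j : ℝ) :=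
  psd_of_checks (pY 4) (cholY 4) (residY 4) (offSumY 4) (residY_eq 4) (fun _ => rfl)
    (fun h hh => by interval_cases h; exacts [certDomY_4_lo, certDomY_4_hi]) certSymY_4 v
/-- certificate matrix `Y5` is PSD. [folklore] -/
theorem quadY5_nonneg (v : ℕ → ℝ) : 0 ≤ ∑ i ∈ range 58, ∑ j ∈ range 58, v i * v j * (pY 5 i j : ℝ) :=
  psd_of_checks (pY 5) (cholY 5) (residY 5) (offSumY 5) (residY_eq 5) (fun _ => rfl)
    (fun h hh => by interval_cases h; exacts [certDomY_5_lo, certDomY_5_hi]) certSymY_5 v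
/-- certificate matrix `Y6` is PSD. [folklore] -/
theorem quadY6_nonneg (v : ℕ → ℝ) : 0 ≤ ∑ i ∈ range 58, ∑ j ∈ range 58, v i * v j * (pY 6 i j : ℝ) :=
  psd_of_checks (pY 6) (cholY 6) (residY 6) (offSumY 6) (residY_eq 6) (fun _ => rfl)
    (fun h hh => by interval_cases h; exacts [certDomY_6_lo, certDomY_6_hi]) certSymY_6 v

/-! ## Expanding the certificate matrices into the reduced forms -/

/-- generic expansion of `α·l + β·h + diag(n8·d) + γ·(n8 w)(n8 w)ᵀ`. [folklore] -/
theorem quad_expand (v : ℕ → ℝ) (α β γ : ℝ) (d : ℕ → ℝ) (w : ℕ → ℕ) (P : ℕ → ℕ → ℤ)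
    (hP : ∀ r < 58, ∀ s < 58, (P r s : ℝ) = α * ((lLit r s : ℤ) : ℝ) + β * (hLit r s : ℝ)
        + (if r = s then (n8 r : ℝ) * d r else 0) + γ * (((n8 r * w r : ℕ) : ℝ) * ((n8 s * w s : ℕ) : ℝ))) :
    ∑ r ∈ range 58, ∑ s ∈ range 58, v r * v s * (P r s : ℝ)
      = α * lowerC v + 4 * β * hopC v + (∑ r ∈ range 58, (n8 r : ℝ) * d r * v r ^ 2) + γ * linC w v ^ 2 := by
  have e : ∀ r ∈ range 58, ∀ s ∈ range 58, v r * v s * (P r s : ℝ)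
      = α * (v r * v s * ((lLit r s : ℤ) : ℝ)) + β * (v r * v s * (hLit r s : ℝ))
        + v r * v s * (if r = s then (n8 r : ℝ) * d r else 0) + γ * (v r * v s * (((n8 r : ℝ) * (w r : ℝ)) * ((n8 s : ℝ) * (w s : ℝ)))) := by
    intro r hr s hs
    rw [hP r (mem_range.1 hr) s (mem_range.1 hs)]; push_cast; ring
  rw [Finset.sum_congr rfl (fun r hr => Finset.sum_congr rfl (fun s hs => e r hr s hs))]
  simp only [Finset.sum_add_distrib, ← Finset.mul_sum]
  rw [quad_lLit, quad_hLit, quad_diag, quad_rankOne]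
  unfold linC
  have hl : (∑ r ∈ range 58, (n8 r : ℝ) * (w r : ℝ) * v r) = ∑ r ∈ range 58, ((n8 r : ℝ) * (w r : ℝ)) * v r :=
    Finset.sum_congr rfl fun r _ => by ring
  have hd : (∑ r ∈ range 58, (n8 r : ℝ) * d r * v r ^ 2) = ∑ r ∈ range 58, ((n8 r : ℝ) * d r) * v r ^ 2 :=
    Finset.sum_congr rfl fun r _ => by ring
  rw [hl, hd]; ring

/-- `dev32C` as a diagonal sum in `activeEdges`. [folklore] -/
theorem dev32C_eq (v : ℕ → ℝ) :
    dev32C v = (1/4 : ℝ) * ∑ r ∈ range 58, (n8 r : ℝ) * (19 - (activeEdges r : ℝ)) ^ 2 * v r ^ 2 := by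
  unfold dev32C; rw [Finset.mul_sum]; exact Finset.sum_congr rfl fun r _ => by ring

/-- **`X0` in reduced forms (gap certificate):** `0 ≤ nw0c·(20A + 20W − 38N)(v) + 70·lin(w0, v)²`. [folklore] -/
theorem certX0 (v : ℕ → ℝ) : 0 ≤ (nw0c : ℝ) * (20 * hopC v + 20 * isingC v - 38 * normC v) + 70 * linC w0 v ^ 2 := by
  have h := quadX0_nonneg v
  rw [quad_expand v 0 (5 * (nw0c : ℝ)) 70 (fun r => (nw0c : ℝ) * (10 * (16 - (activeEdges r : ℝ)) - 38)) w0 (pX 0)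
    (fun r hr s hs => by
      show ((pX 0 r s : ℤ) : ℝ) = _
      unfold pX; simp only
      rw [aLit_eq hr]; push_cast; split_ifs <;> ring)] at h
  have hd : (∑ r ∈ range 58, (n8 r : ℝ) * ((nw0c : ℝ) * (10 * (16 - (activeEdges r : ℝ)) - 38)) * v r ^ 2)
      = (nw0c : ℝ) * (2 * 10 * isingC v + (-38) * normC v) := by
    rw [← diag_sum, Finset.mul_sum]; exact Finset.sum_congr rfl fun r _ => by ring
  rw [hd] at h; nlinarith [h]

/-- **`Y1` (variance certificate):** `0 ≤ nac·(800A + 800W + 92N − 40D₃₂)(v) − 200·eac·N(v)`. [folklore] -/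
theorem certY1 (v : ℕ → ℝ) :
    0 ≤ (nac : ℝ) * (800 * hopC v + 800 * isingC v + 92 * normC v - 40 * dev32C v) - 200 * (eac : ℝ) * normC v := by
  have h := quadY1_nonneg v
  rw [quad_expand v 0 (200 * (nac : ℝ)) 0
      (fun r => (nac : ℝ) * (92 + 400 * (16 - (activeEdges r : ℝ)) - 10 * (19 - (activeEdges r : ℝ)) ^ 2) - 200 * (eac : ℝ)) w0 (pY 1)
    (fun r hr s hs => by
      show ((pY 1 r s : ℤ) : ℝ) = _
      unfold pY; simp only
      rw [aLit_eq hr]; push_cast; split_ifs <;> ring)] at h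
  have hd : (∑ r ∈ range 58, (n8 r : ℝ) * ((nac : ℝ) * (92 + 400 * (16 - (activeEdges r : ℝ)) - 10 * (19 - (activeEdges r : ℝ)) ^ 2) - 200 * (eac : ℝ)) * v r ^ 2)
      = (nac : ℝ) * (2 * 400 * isingC v + 92 * normC v) - (nac : ℝ) * 40 * dev32C v - 200 * (eac : ℝ) * normC v := by
    rw [← diag_sum, dev32C_eq]
    unfold normC
    rw [Finset.mul_sum, Finset.mul_sum, Finset.mul_sum, Finset.mul_sum, ← Finset.sum_sub_distrib, ← Finset.sum_sub_distrib]
    exact Finset.sum_congr rfl fun r _ => by ring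
  rw [hd] at h; nlinarith [h]

/-- **`Y2`:** `0 ≤ nac·(4L + 320A + 320W − 266N)(v) − 80·eac·N(v)` (`Λ₀ ≥ 133/2`). [folklore] -/
theorem certY2 (v : ℕ → ℝ) :
    0 ≤ (nac : ℝ) * (4 * lowerC v + 320 * hopC v + 320 * isingC v - 266 * normC v) - 80 * (eac : ℝ) * normC v := by
  have h := quadY2_nonneg v
  rw [quad_expand v (4 * (nac : ℝ)) (80 * (nac : ℝ)) 0
      (fun r => (nac : ℝ) * (160 * (16 - (activeEdges r : ℝ)) - 266) - 80 * (eac : ℝ)) w0 (pY 2)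
    (fun r hr s hs => by
      show ((pY 2 r s : ℤ) : ℝ) = _
      unfold pY; simp only
      rw [aLit_eq hr]; push_cast; split_ifs <;> ring)] at h
  have hd : (∑ r ∈ range 58, (n8 r : ℝ) * ((nac : ℝ) * (160 * (16 - (activeEdges r : ℝ)) - 266) - 80 * (eac : ℝ)) * v r ^ 2)
      = (nac : ℝ) * (2 * 160 * isingC v + (-266) * normC v) - 80 * (eac : ℝ) * normC v := by
    rw [← diag_sum]; unfold normC
    rw [Finset.mul_sum, Finset.mul_sum, ← Finset.sum_sub_distrib]
    exact Finset.sum_congr rfl fun r _ => by ring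
  rw [hd] at h; nlinarith [h]

/-- **`Y3`:** `0 ≤ nac·(−4L + 240A + 240W + 278N)(v) − 60·eac·N(v)` (`Λ₀ ≤ 139/2`). [folklore] -/
theorem certY3 (v : ℕ → ℝ) :
    0 ≤ (nac : ℝ) * (-4 * lowerC v + 240 * hopC v + 240 * isingC v + 278 * normC v) - 60 * (eac : ℝ) * normC v := by
  have h := quadY3_nonneg v
  rw [quad_expand v (-(4 * (nac : ℝ))) (60 * (nac : ℝ)) 0
      (fun r => (nac : ℝ) * (120 * (16 - (activeEdges r : ℝ)) + 278) - 60 * (eac : ℝ)) w0 (pY 3)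
    (fun r hr s hs => by
      show ((pY 3 r s : ℤ) : ℝ) = _
      unfold pY; simp only
      rw [aLit_eq hr]; push_cast; split_ifs <;> ring)] at h
  have hd : (∑ r ∈ range 58, (n8 r : ℝ) * ((nac : ℝ) * (120 * (16 - (activeEdges r : ℝ)) + 278) - 60 * (eac : ℝ)) * v r ^ 2)
      = (nac : ℝ) * (2 * 120 * isingC v + 278 * normC v) - 60 * (eac : ℝ) * normC v := by
    rw [← diag_sum]; unfold normC
    rw [Finset.mul_sum, Finset.mul_sum, ← Finset.sum_sub_distrib]
    exact Finset.sum_congr rfl fun r _ => by ring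
  rw [hd] at h; nlinarith [h]

/-- **`Y4`:** `0 ≤ nac·(40A + 36W − 5N)(v) − 10·eac·N(v)` (`⟨W⟩₀ ≤ −5/4`). [folklore] -/
theorem certY4 (v : ℕ → ℝ) :
    0 ≤ (nac : ℝ) * (40 * hopC v + 36 * isingC v - 5 * normC v) - 10 * (eac : ℝ) * normC v := by
  have h := quadY4_nonneg v
  rw [quad_expand v 0 (10 * (nac : ℝ)) 0
      (fun r => (nac : ℝ) * (18 * (16 - (activeEdges r : ℝ)) - 5) - 10 * (eac : ℝ)) w0 (pY 4)
    (fun r hr s hs => by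
      show ((pY 4 r s : ℤ) : ℝ) = _
      unfold pY; simp only
      rw [aLit_eq hr]; push_cast; split_ifs <;> ring)] at h
  have hd : (∑ r ∈ range 58, (n8 r : ℝ) * ((nac : ℝ) * (18 * (16 - (activeEdges r : ℝ)) - 5) - 10 * (eac : ℝ)) * v r ^ 2)
      = (nac : ℝ) * (2 * 18 * isingC v + (-5) * normC v) - 10 * (eac : ℝ) * normC v := by
    rw [← diag_sum]; unfold normC
    rw [Finset.mul_sum, Finset.mul_sum, ← Finset.sum_sub_distrib]
    exact Finset.sum_congr rfl fun r _ => by ring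
  rw [hd] at h; nlinarith [h]

/-- **`Y5` (`Δ = −1`):** `0 ≤ nbc·(4L + 240A + 480W)(v) − 60·ebm·N(v)`. [folklore] -/
theorem certY5 (v : ℕ → ℝ) :
    0 ≤ (nbc : ℝ) * (4 * lowerC v + 240 * hopC v + 480 * isingC v) - 60 * (ebm : ℝ) * normC v := by
  have h := quadY5_nonneg v
  rw [quad_expand v (4 * (nbc : ℝ)) (60 * (nbc : ℝ)) 0
      (fun r => (nbc : ℝ) * (240 * (16 - (activeEdges r : ℝ))) - 60 * (ebm : ℝ)) w0 (pY 5)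
    (fun r hr s hs => by
      show ((pY 5 r s : ℤ) : ℝ) = _
      unfold pY; simp only
      rw [aLit_eq hr]; push_cast; split_ifs <;> ring)] at h
  have hd : (∑ r ∈ range 58, (n8 r : ℝ) * ((nbc : ℝ) * (240 * (16 - (activeEdges r : ℝ))) - 60 * (ebm : ℝ)) * v r ^ 2)
      = (nbc : ℝ) * (2 * 240 * isingC v + 0 * normC v) - 60 * (ebm : ℝ) * normC v := by
    rw [← diag_sum]; unfold normC
    rw [Finset.mul_sum, Finset.mul_sum, ← Finset.sum_sub_distrib]
    exact Finset.sum_congr rfl fun r _ => by ring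
  rw [hd] at h; nlinarith [h]

/-- **`Y6` (`Δ = −17/200`):** `0 ≤ nbc·(800L + 48000A + 52080W − 50874N)(v) − ebj·N(v)`. [folklore] -/
theorem certY6 (v : ℕ → ℝ) :
    0 ≤ (nbc : ℝ) * (800 * lowerC v + 48000 * hopC v + 52080 * isingC v - 50874 * normC v) - (ebj : ℝ) * normC v := by
  have h := quadY6_nonneg v
  rw [quad_expand v (800 * (nbc : ℝ)) (12000 * (nbc : ℝ)) 0
      (fun r => (nbc : ℝ) * (26040 * (16 - (activeEdges r : ℝ)) - 50874) - (ebj : ℝ)) w0 (pY 6)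
    (fun r hr s hs => by
      show ((pY 6 r s : ℤ) : ℝ) = _
      unfold pY; simp only
      rw [aLit_eq hr]; push_cast; split_ifs <;> ring)] at h
  have hd : (∑ r ∈ range 58, (n8 r : ℝ) * ((nbc : ℝ) * (26040 * (16 - (activeEdges r : ℝ)) - 50874) - (ebj : ℝ)) * v r ^ 2)
      = (nbc : ℝ) * (2 * 26040 * isingC v + (-50874) * normC v) - (ebj : ℝ) * normC v := by
    rw [← diag_sum]; unfold normC
    rw [Finset.mul_sum, Finset.mul_sum, ← Finset.sum_sub_distrib]
    exact Finset.sum_congr rfl fun r _ => by ring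
  rw [hd] at h; nlinarith [h]

end Summit.HubbardSuperconductivity.HubbardSuperconductivity.Theorems.AnisotropyChord.FourTorus
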